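import Literature.MathematicalPhysics.QuantumFieldTheory.Balaban1983to89.B7TransferAnalyticMean
import Summits.QuantumFields.YangMills.Theorems.BalabanUVNodesC44IterMhGaugeCovariance
import HarnessLib

/-!
# (ℓa-C) ROAD B, FILE F4′-2a — NORMED-ALGEBRA BOOKKEEPING FOR THE POLYDISC STABILITY: products of near-identity factors to first order, inverses and
# conjugations near `1`, unitary conjugation, the elementary real inequalities

Cell `pub-ymgap` ∕ `ym-nodeO-ideate`, porter lineage `ymgap-nodeO-port-PTB-1` (gen 7), hand «(44) for `iterMh`» (director-ym g22 №569/№571; PORT-PLAN-v5 dc7ff9950b0ac185,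
§ F4′-2).  `--kind proof --supports stmt-QuantumFields-27238 --as helper`; count-neutral.  [B7] = [Balaban1985Averaging]; [B11] = [Balaban1985Variational]; [I] = [Balaban1987RG1].

WHY.  The k-free stability of the holomorphic tower (F4′) is a FIRST-ORDER bookkeeping of products of matrices within `O(t)` of `1` with second-order remainders
([B7] Sect. A (20)–(26), Sect. D (111)–(112) «`(1/i) log(R_{0,y}V₁)(Γ) = (R_{0,y}A)(Γ) + O((|A|(Γ))²)`»): every loop matrix of the perturbed field is a product of transported
near-identity factors times the background loop.  This file isolates the generic inequalities, with explicit constants, so that the dressing (F4′-2b) and the one-step estimate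
(F4′-3) are pure assembly.

WHAT IS PROVED (0 def, 0 sorry, axioms standard; ns `Summit.QuantumFields.YangMills.Theorems.C44IterMh`).
* §1 (any normed ring) `norm_mul_sub_one_le_prod` (`‖ab − 1‖ ≤ (1+‖a−1‖)(1+‖b−1‖) − 1`), `norm_mul_sub_one_sub_sum₂_le` (`‖ab − 1 − ((a−1)+(b−1))‖ ≤ ‖a−1‖‖b−1‖`),
  `norm_mul_sub_one_le_of_le₂`, ★ `norm_mul4_sub_one_le` ∕ ★★ `norm_mul4_sub_one_sub_sum_le` (four factors with displayed bounds `α β γ δ`: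
  `‖abcd − 1 − Σ(·−1)‖ ≤ Π(1+·) − 1 − Σ·`), the real tails `prod4_sub_one_le_two_mul` (`≤ 2σ`) and `prod4_sub_one_sub_sum_le_sq` (`≤ σ²`) for `σ = α+β+γ+δ ≤ 1`,
  `pow_sub_one_sub_le_sq` (`(1+a)^n − 1 − na ≤ (na)²`; the first-order `(1+a)^n − 1 ≤ 2na` is the landed ✓`Prop7CombTreeRem2Letters.one_add_pow_sub_one_le_two_mul'`).
* §2 (`M_N(ℂ)`, L2-operator norm) `norm_inv_sub_one_le_of_det` (`‖D⁻¹ − 1‖ ≤ 2δ`), ★ `norm_inv_sub_one_add_le_of_det` (`‖D⁻¹ − 1 + (D−1)‖ ≤ 2δ²`) for `‖D − 1‖ ≤ δ ≤ 1∕2`,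
  `IsUnit D.det`; ★ `norm_conj_inv_sub_self_le` (`‖PAP⁻¹ − A‖ ≤ 4‖P−1‖·‖A‖` for `‖P − 1‖ ≤ 1∕2`); `norm_unitary_conj`, `norm_unitary_conj_sub_one_eq`, `norm_star_unitary_conj`,
  `norm_star_unitary_conj_sub_one_eq` (unitary conjugation is an isometry, [B7] p.24 «unitarily equivalent»).

HONEST FRAMING.  Elementary inequalities; nothing of [B7] Props 1–3∕7 or [B11] (44) is proved here.  (ℓa-C)(ℓa-H)(ℓd) DISPLAYED; (R1)∕(R2) OPEN; K0ᴬ ⟨stmt-QuantumFields-27238⟩ NOT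
closed; K0ᴬ∕K1ᴬ∕K3ᴬ 0∕3; NODE O 0∕1; COUNT 8∕28 · K 1∕4 UNMOVED; finite `𝕋⁴_{L^K}` at fixed ε — NOT continuum ∕ ℝ⁴ ∕ OS; **the Yang–Mills mass gap (Clay) is NOT proved by any of
this.**  No `sorry`, `instance`, `notation`, `set_option`; standard axioms.
-/

noncomputable section

open scoped Matrix Matrix.Norms.L2Operator

namespace Summit.QuantumFields.YangMills.Theorems.C44IterMh

/-! ## §1  Products of near-identity factors, to first order, in a normed ring -/

section Ring

variable {𝔸 : Type*} [NormedRing 𝔸]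

/-- `‖ab − 1‖ ≤ (1 + ‖a−1‖)(1 + ‖b−1‖) − 1` (`ab − 1 = (a−1)(b−1) + (a−1) + (b−1)`). [cite: Balaban1985Averaging, (20) p.21] -/
theorem norm_mul_sub_one_le_prod (a b : 𝔸) : ‖a * b - 1‖ ≤ (1 + ‖a - 1‖) * (1 + ‖b - 1‖) - 1 := by
  have h : a * b - 1 = (a - 1) * (b - 1) + (a - 1) + (b - 1) := by noncomm_ring
  rw [h]
  calc ‖(a - 1) * (b - 1) + (a - 1) + (b - 1)‖ ≤ ‖(a - 1) * (b - 1)‖ + ‖a - 1‖ + ‖b - 1‖ := norm_add₃_le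
    _ ≤ ‖a - 1‖ * ‖b - 1‖ + ‖a - 1‖ + ‖b - 1‖ := by gcongr; exact norm_mul_le _ _
    _ = (1 + ‖a - 1‖) * (1 + ‖b - 1‖) - 1 := by ring

/-- `‖ab − 1 − ((a−1) + (b−1))‖ ≤ ‖a−1‖·‖b−1‖` — the product to FIRST ORDER. [cite: Balaban1985Averaging, (111) p.34] -/
theorem norm_mul_sub_one_sub_sum₂_le (a b : 𝔸) : ‖a * b - 1 - ((a - 1) + (b - 1))‖ ≤ ‖a - 1‖ * ‖b - 1‖ := by
  have h : a * b - 1 - ((a - 1) + (b - 1)) = (a - 1) * (b - 1) := by noncomm_ring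
  rw [h]
  exact norm_mul_le _ _

/-- `‖ab − 1‖ ≤ (1+α)(1+β) − 1` from `‖a−1‖ ≤ α`, `‖b−1‖ ≤ β`. [cite: Balaban1985Averaging, (20) p.21] -/
theorem norm_mul_sub_one_le_of_le₂ {a b : 𝔸} {α β : ℝ} (ha : ‖a - 1‖ ≤ α) (hb : ‖b - 1‖ ≤ β) : ‖a * b - 1‖ ≤ (1 + α) * (1 + β) - 1 := by
  have h0a := norm_nonneg (a - 1)
  have h0b := norm_nonneg (b - 1)
  refine (norm_mul_sub_one_le_prod a b).trans ?_
  have : (1 + ‖a - 1‖) * (1 + ‖b - 1‖) ≤ (1 + α) * (1 + β) := mul_le_mul (by linarith) (by linarith) (by linarith) (by linarith)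
  linarith

/-- ★ `‖abcd − 1‖ ≤ (1+α)(1+β)(1+γ)(1+δ) − 1` from the four displayed bounds. [cite: Balaban1985Averaging, (20) p.21] -/
theorem norm_mul4_sub_one_le {a b c d : 𝔸} {α β γ δ : ℝ} (ha : ‖a - 1‖ ≤ α) (hb : ‖b - 1‖ ≤ β) (hc : ‖c - 1‖ ≤ γ) (hd : ‖d - 1‖ ≤ δ) :
    ‖a * b * c * d - 1‖ ≤ (1 + α) * (1 + β) * (1 + γ) * (1 + δ) - 1 := by
  have h2 := norm_mul_sub_one_le_of_le₂ ha hb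
  have h3 := norm_mul_sub_one_le_of_le₂ h2 hc
  have h4 := norm_mul_sub_one_le_of_le₂ h3 hd
  refine h4.trans (le_of_eq ?_)
  ring

/-- ★★ **FOUR NEAR-IDENTITY FACTORS TO FIRST ORDER**: `‖abcd − 1 − ((a−1)+(b−1)+(c−1)+(d−1))‖ ≤ (1+α)(1+β)(1+γ)(1+δ) − 1 − (α+β+γ+δ)` from the four displayed bounds
(the loop `Γ·[x,x′]·Γ′⁻¹·c⁻¹` of (0.4) has four segments). [cite: Balaban1985Averaging, (111)–(112) p.34; Balaban1987RG1, (0.4) p.253] -/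
theorem norm_mul4_sub_one_sub_sum_le {a b c d : 𝔸} {α β γ δ : ℝ} (ha : ‖a - 1‖ ≤ α) (hb : ‖b - 1‖ ≤ β) (hc : ‖c - 1‖ ≤ γ) (hd : ‖d - 1‖ ≤ δ) :
    ‖a * b * c * d - 1 - ((a - 1) + (b - 1) + (c - 1) + (d - 1))‖ ≤ (1 + α) * (1 + β) * (1 + γ) * (1 + δ) - 1 - (α + β + γ + δ) := by
  have h0a := norm_nonneg (a - 1)
  have h0b := norm_nonneg (b - 1)
  have h0c := norm_nonneg (c - 1)
  have h0d := norm_nonneg (d - 1)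
  -- second-order pieces of the successive products
  have e2 := norm_mul_sub_one_sub_sum₂_le a b
  have m2 := norm_mul_sub_one_le_of_le₂ ha hb
  have e3 := norm_mul_sub_one_sub_sum₂_le (a * b) c
  have m3 : ‖a * b * c - 1‖ ≤ (1 + α) * (1 + β) * (1 + γ) - 1 := (norm_mul_sub_one_le_of_le₂ m2 hc).trans (le_of_eq (by ring))
  have e4 := norm_mul_sub_one_sub_sum₂_le (a * b * c) d
  have hsplit : a * b * c * d - 1 - ((a - 1) + (b - 1) + (c - 1) + (d - 1))
      = (a * b * c * d - 1 - ((a * b * c - 1) + (d - 1))) + (a * b * c - 1 - ((a * b - 1) + (c - 1))) + (a * b - 1 - ((a - 1) + (b - 1))) := by abel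
  rw [hsplit]
  have hb2 : ‖a * b - 1 - ((a - 1) + (b - 1))‖ ≤ α * β := e2.trans (mul_le_mul ha hb h0b (h0a.trans ha))
  have hb3 : ‖a * b * c - 1 - ((a * b - 1) + (c - 1))‖ ≤ ((1 + α) * (1 + β) - 1) * γ :=
    e3.trans (mul_le_mul m2 hc h0c ((norm_nonneg _).trans m2))
  have hb4 : ‖a * b * c * d - 1 - ((a * b * c - 1) + (d - 1))‖ ≤ ((1 + α) * (1 + β) * (1 + γ) - 1) * δ :=
    e4.trans (mul_le_mul m3 hd h0d ((norm_nonneg _).trans m3))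
  calc _ ≤ ‖a * b * c * d - 1 - ((a * b * c - 1) + (d - 1))‖ + ‖a * b * c - 1 - ((a * b - 1) + (c - 1))‖ + ‖a * b - 1 - ((a - 1) + (b - 1))‖ := norm_add₃_le
    _ ≤ ((1 + α) * (1 + β) * (1 + γ) - 1) * δ + ((1 + α) * (1 + β) - 1) * γ + α * β := by linarith
    _ = (1 + α) * (1 + β) * (1 + γ) * (1 + δ) - 1 - (α + β + γ + δ) := by ring

/-- The real tail `(1+α)(1+β)(1+γ)(1+δ) − 1 ≤ 2σ` for `σ = α+β+γ+δ ≤ 1`, nonnegative entries (`Π(1+·) ≤ e^σ`, `e^σ − 1 ≤ 2σ`). [folklore] -/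
theorem prod4_sub_one_le_two_mul {α β γ δ : ℝ} (hα : 0 ≤ α) (hβ : 0 ≤ β) (hγ : 0 ≤ γ) (hδ : 0 ≤ δ) (hσ : α + β + γ + δ ≤ 1) :
    (1 + α) * (1 + β) * (1 + γ) * (1 + δ) - 1 ≤ 2 * (α + β + γ + δ) := by
  have hprod : (1 + α) * (1 + β) * (1 + γ) * (1 + δ) ≤ Real.exp (α + β + γ + δ) := by
    rw [Real.exp_add, Real.exp_add, Real.exp_add]
    have ea := Real.add_one_le_exp α
    have eb := Real.add_one_le_exp β
    have ec := Real.add_one_le_exp γ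
    have ed := Real.add_one_le_exp δ
    have := mul_le_mul (mul_le_mul (mul_le_mul ea eb (by linarith) (Real.exp_pos _).le) ec (by linarith) (by positivity)) ed (by linarith) (by positivity)
    linarith
  have hσ0 : 0 ≤ α + β + γ + δ := by linarith
  have htail := Real.abs_exp_sub_one_le (x := α + β + γ + δ) (by rwa [abs_of_nonneg hσ0])
  rw [abs_of_nonneg hσ0] at htail
  linarith [le_abs_self (Real.exp (α + β + γ + δ) - 1)]

/-- The real tail to second order: `(1+α)(1+β)(1+γ)(1+δ) − 1 − σ ≤ σ²` for `σ = α+β+γ+δ ≤ 1`, nonnegative entries. [folklore] -/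
theorem prod4_sub_one_sub_sum_le_sq {α β γ δ : ℝ} (hα : 0 ≤ α) (hβ : 0 ≤ β) (hγ : 0 ≤ γ) (hδ : 0 ≤ δ) (hσ : α + β + γ + δ ≤ 1) :
    (1 + α) * (1 + β) * (1 + γ) * (1 + δ) - 1 - (α + β + γ + δ) ≤ (α + β + γ + δ) ^ 2 := by
  have hprod : (1 + α) * (1 + β) * (1 + γ) * (1 + δ) ≤ Real.exp (α + β + γ + δ) := by
    rw [Real.exp_add, Real.exp_add, Real.exp_add]
    have ea := Real.add_one_le_exp α
    have eb := Real.add_one_le_exp β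
    have ec := Real.add_one_le_exp γ
    have ed := Real.add_one_le_exp δ
    have := mul_le_mul (mul_le_mul (mul_le_mul ea eb (by linarith) (Real.exp_pos _).le) ec (by linarith) (by positivity)) ed (by linarith) (by positivity)
    linarith
  have hσ0 : 0 ≤ α + β + γ + δ := by linarith
  have htail := Real.abs_exp_sub_one_sub_id_le (x := α + β + γ + δ) (by rwa [abs_of_nonneg hσ0])
  linarith [le_abs_self (Real.exp (α + β + γ + δ) - 1 - (α + β + γ + δ))]

/-- `(1 + a)^n − 1 − na ≤ (na)²` for `0 ≤ a`, `na ≤ 1`. [folklore] -/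
theorem pow_sub_one_sub_le_sq {a : ℝ} (ha : 0 ≤ a) (n : ℕ) (hn : (n : ℝ) * a ≤ 1) : (1 + a) ^ n - 1 - (n : ℝ) * a ≤ ((n : ℝ) * a) ^ 2 := by
  have hna : 0 ≤ (n : ℝ) * a := by positivity
  have hpow : (1 + a) ^ n ≤ Real.exp ((n : ℝ) * a) :=
    calc (1 + a) ^ n ≤ (Real.exp a) ^ n := pow_le_pow_left₀ (by linarith) (by linarith [Real.add_one_le_exp a]) n
      _ = Real.exp ((n : ℝ) * a) := (Real.exp_nat_mul a n).symm
  have htail := Real.abs_exp_sub_one_sub_id_le (x := (n : ℝ) * a) (by rwa [abs_of_nonneg hna])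
  linarith [le_abs_self (Real.exp ((n : ℝ) * a) - 1 - (n : ℝ) * a)]

end Ring

/-! ## §2  `M_N(ℂ)` with the L2-operator norm: inverses and conjugations near `1`, unitary conjugation -/

section Matrices

variable {N : ℕ}

/-- `‖D⁻¹ − 1‖ ≤ 2δ` for `‖D − 1‖ ≤ δ ≤ 1∕2`, `D` invertible (`D⁻¹ − 1 = D⁻¹(1 − D)`, no series needed). [cite: Balaban1985Averaging, (20) p.21] -/
theorem norm_inv_sub_one_le_of_det [NeZero N] {D : Matrix (Fin N) (Fin N) ℂ} (hD : IsUnit D.det) {δ : ℝ} (h : ‖D - 1‖ ≤ δ) (hδ : δ ≤ 1 / 2) :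
    ‖D⁻¹ - 1‖ ≤ 2 * δ := by
  haveI : Nonempty (Fin N) := ⟨⟨0, Nat.pos_of_ne_zero (NeZero.ne N)⟩⟩
  have h1 : D⁻¹ - 1 = D⁻¹ * (1 - D) := by rw [mul_sub, mul_one, Matrix.nonsing_inv_mul D hD]
  have hx0 := norm_nonneg (D⁻¹ - 1)
  have hδ0 : 0 ≤ δ := (norm_nonneg _).trans h
  have hinv : ‖D⁻¹‖ ≤ 1 + ‖D⁻¹ - 1‖ := by
    calc ‖D⁻¹‖ = ‖(D⁻¹ - 1) + 1‖ := by rw [sub_add_cancel]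
      _ ≤ ‖D⁻¹ - 1‖ + ‖(1 : Matrix (Fin N) (Fin N) ℂ)‖ := norm_add_le _ _
      _ = 1 + ‖D⁻¹ - 1‖ := by rw [norm_one, add_comm]
  have hx : ‖D⁻¹ - 1‖ ≤ (1 + ‖D⁻¹ - 1‖) * δ := by
    calc ‖D⁻¹ - 1‖ = ‖D⁻¹ * (1 - D)‖ := by rw [h1]
      _ ≤ ‖D⁻¹‖ * ‖1 - D‖ := norm_mul_le _ _
      _ ≤ (1 + ‖D⁻¹ - 1‖) * δ := mul_le_mul hinv (by rw [norm_sub_rev]; exact h) (norm_nonneg _) (by positivity)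
  nlinarith [mul_nonneg hx0 (sub_nonneg.2 hδ)]

/-- ★ `‖D⁻¹ − 1 + (D − 1)‖ ≤ 2δ²` for `‖D − 1‖ ≤ δ ≤ 1∕2` — the inverse to FIRST ORDER (`D⁻¹ − 1 + (D−1) = D⁻¹(D−1)²`). [cite: Balaban1985Averaging, (20)–(23) p.21] -/
theorem norm_inv_sub_one_add_le_of_det [NeZero N] {D : Matrix (Fin N) (Fin N) ℂ} (hD : IsUnit D.det) {δ : ℝ} (h : ‖D - 1‖ ≤ δ) (hδ : δ ≤ 1 / 2) :
    ‖D⁻¹ - 1 + (D - 1)‖ ≤ 2 * δ ^ 2 := by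
  haveI : Nonempty (Fin N) := ⟨⟨0, Nat.pos_of_ne_zero (NeZero.ne N)⟩⟩
  have hDD : D⁻¹ * D = 1 := Matrix.nonsing_inv_mul D hD
  have h1 : D⁻¹ - 1 + (D - 1) = D⁻¹ * (D - 1) * (D - 1) := by
    have : D⁻¹ * (D - 1) * (D - 1) = D⁻¹ * D * D - D⁻¹ * D - D⁻¹ * D + D⁻¹ := by noncomm_ring
    rw [this, hDD]; noncomm_ring
  have hδ0 : 0 ≤ δ := (norm_nonneg _).trans h
  have hinv' := norm_inv_sub_one_le_of_det hD h hδ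
  have hinv : ‖D⁻¹‖ ≤ 1 + 2 * δ := by
    calc ‖D⁻¹‖ = ‖(D⁻¹ - 1) + 1‖ := by rw [sub_add_cancel]
      _ ≤ ‖D⁻¹ - 1‖ + ‖(1 : Matrix (Fin N) (Fin N) ℂ)‖ := norm_add_le _ _
      _ ≤ 1 + 2 * δ := by rw [norm_one]; linarith
  rw [h1]
  calc ‖D⁻¹ * (D - 1) * (D - 1)‖ ≤ ‖D⁻¹‖ * ‖D - 1‖ * ‖D - 1‖ := by
        refine (norm_mul_le _ _).trans ?_; gcongr; exact norm_mul_le _ _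
    _ ≤ (1 + 2 * δ) * δ * δ := by gcongr
    _ ≤ 2 * δ ^ 2 := by nlinarith

/-- ★ **CONJUGATION BY A NEAR-IDENTITY MATRIX**: `‖P·A·P⁻¹ − A‖ ≤ 4‖P − 1‖·‖A‖` for `‖P − 1‖ ≤ 1∕2` (`PAP⁻¹ − A = (P−1)AP⁻¹ + A(P⁻¹−1)`).
[cite: Balaban1985Averaging, (56)–(57) p.27] -/
theorem norm_conj_inv_sub_self_le [NeZero N] {P : Matrix (Fin N) (Fin N) ℂ} (hP : IsUnit P.det) {p : ℝ} (hp : ‖P - 1‖ ≤ p) (hp2 : p ≤ 1 / 2)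
    (A : Matrix (Fin N) (Fin N) ℂ) : ‖P * A * P⁻¹ - A‖ ≤ 4 * p * ‖A‖ := by
  haveI : Nonempty (Fin N) := ⟨⟨0, Nat.pos_of_ne_zero (NeZero.ne N)⟩⟩
  have hp0 : 0 ≤ p := (norm_nonneg _).trans hp
  have h1 : P * A * P⁻¹ - A = (P - 1) * A * P⁻¹ + A * (P⁻¹ - 1) := by
    have hPP : P * P⁻¹ = 1 := Matrix.mul_nonsing_inv P hP
    have : (P - 1) * A * P⁻¹ + A * (P⁻¹ - 1) = P * A * P⁻¹ - A * P⁻¹ + A * P⁻¹ - A := by noncomm_ring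
    rw [this]; abel
  have hinv1 := norm_inv_sub_one_le_of_det hP hp hp2
  have hinv : ‖P⁻¹‖ ≤ 1 + 2 * p := by
    calc ‖P⁻¹‖ = ‖(P⁻¹ - 1) + 1‖ := by rw [sub_add_cancel]
      _ ≤ ‖P⁻¹ - 1‖ + ‖(1 : Matrix (Fin N) (Fin N) ℂ)‖ := norm_add_le _ _
      _ ≤ 1 + 2 * p := by rw [norm_one]; linarith
  rw [h1]
  calc ‖(P - 1) * A * P⁻¹ + A * (P⁻¹ - 1)‖ ≤ ‖(P - 1) * A * P⁻¹‖ + ‖A * (P⁻¹ - 1)‖ := norm_add_le _ _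
    _ ≤ ‖P - 1‖ * ‖A‖ * ‖P⁻¹‖ + ‖A‖ * ‖P⁻¹ - 1‖ := by
        gcongr
        · exact (norm_mul_le _ _).trans (mul_le_mul_of_nonneg_right (norm_mul_le _ _) (norm_nonneg _))
        · exact norm_mul_le _ _
    _ ≤ p * ‖A‖ * (1 + 2 * p) + ‖A‖ * (2 * p) := by gcongr
    _ ≤ 4 * p * ‖A‖ := by nlinarith [norm_nonneg A, mul_nonneg (norm_nonneg A) (mul_nonneg hp0 (sub_nonneg.2 hp2))]

/-- **UNITARY CONJUGATION IS AN ISOMETRY**: `‖U·A·U⋆‖ = ‖A‖` for unitary `U` (C⋆-identity of the L2-operator norm). [cite: Balaban1985Averaging, p.24 («unitarily equivalent»)] -/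
theorem norm_unitary_conj {U : Matrix (Fin N) (Fin N) ℂ} (hU : U ∈ Matrix.unitaryGroup (Fin N) ℂ) (A : Matrix (Fin N) (Fin N) ℂ) :
    ‖U * A * star U‖ = ‖A‖ := by
  rw [CStarRing.norm_mul_mem_unitary _ (Unitary.star_mem hU), CStarRing.norm_mem_unitary_mul _ hU]

/-- `‖U·A·U⋆ − 1‖ = ‖A − 1‖` for unitary `U`. [cite: Balaban1985Averaging, p.24 («unitarily equivalent»)] -/
theorem norm_unitary_conj_sub_one_eq {U : Matrix (Fin N) (Fin N) ℂ} (hU : U ∈ Matrix.unitaryGroup (Fin N) ℂ) (A : Matrix (Fin N) (Fin N) ℂ) :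
    ‖U * A * star U - 1‖ = ‖A - 1‖ := by
  have h : U * A * star U - 1 = U * (A - 1) * star U := by
    rw [mul_sub, sub_mul, mul_one, Unitary.mul_star_self_of_mem hU]
  rw [h, norm_unitary_conj hU]

/-- `‖U⋆·A·U‖ = ‖A‖` for unitary `U`. [cite: Balaban1985Averaging, p.24 («unitarily equivalent»)] -/
theorem norm_star_unitary_conj {U : Matrix (Fin N) (Fin N) ℂ} (hU : U ∈ Matrix.unitaryGroup (Fin N) ℂ) (A : Matrix (Fin N) (Fin N) ℂ) :
    ‖star U * A * U‖ = ‖A‖ := by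
  have h := norm_unitary_conj (Unitary.star_mem hU) A
  rwa [star_star] at h

/-- `‖U⋆·A·U − 1‖ = ‖A − 1‖` for unitary `U`. [cite: Balaban1985Averaging, p.24 («unitarily equivalent»)] -/
theorem norm_star_unitary_conj_sub_one_eq {U : Matrix (Fin N) (Fin N) ℂ} (hU : U ∈ Matrix.unitaryGroup (Fin N) ℂ) (A : Matrix (Fin N) (Fin N) ℂ) :
    ‖star U * A * U - 1‖ = ‖A - 1‖ := by
  have h := norm_unitary_conj_sub_one_eq (Unitary.star_mem hU) A
  rwa [star_star] at h

end Matrices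

end Summit.QuantumFields.YangMills.Theorems.C44IterMh

end
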